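import Summits.PneNP.PneNP.Theorems.ChebyshevTracialDesignBlockStatisticPricing
import Literature.Combinatorics.Optimization.ShellLawHalfPinning
import Literature.Analysis.Calculus.ForwardDifferenceLeibniz
import HarnessLib

/-!
# Cell pnp-psdrank, route `ChebyshevTracialDesign`: HALF-PINNED BLOCK STATISTICS ARE VIRTUALLY NULL — the design value
# of `ψ(|U∩H|)·|half_M(U) ∩ H|` is a pure interpolation remainder (crux `TracialDecayExp20`, stmt-PneNP-19878)

Brick 119 (prover g22; MEMO-25 §3, MEMO-24 §6). An exact extrapolation design `(C, w)` of degree `D` on odd levels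
`c ≤ T` prices a level profile `φ` by `Σ_c w_c φ(c) = −N^{odd}_D φ(0) + remainder` (Literature
`abs_levelSum_add_le_of_exact_of_fwdDiff_odd`), and for a plain block statistic `ψ(|U∩H|)` the virtual value
`N^{odd}_D φ(0)` carries the tight-shell term and the signed Newton corrections of brick 117. For a profile that
VANISHES TO FIRST ORDER AT THE VIRTUAL LEVEL, `φ(c) = c·θ(c)`, the virtual value is itself top-order:

* §1 **`newtonPolyOdd_levelMul_eval_zero`**: `N^{odd}_D[c ↦ c·θ(c)](0) = (2D+1)·C(−½, D)·Δ^D θ_odd(0)`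
  (`θ_odd(j) = θ(2j+1)`; Boole's Leibniz rule for `(2j+1)·θ_odd(j)` — Literature `fwdDiff_iter_smul_eq_sum_of_eq_zero` —
  and the telescoping identity `(2k+1)·C(−½,k) + 2(k+1)·C(−½,k+1) = 0`, `Nat.succ_mul_centralBinom_succ`): all
  Newton terms of order `< D` cancel. **`abs_levelSum_levelMul_le`**: hence for every exact `(C,w)` with variation `≤ B`,
  `|Σ_c w_c·c·θ(c)| ≤ (2D+1)·(C(2D,D)/4^D)·K_D + B·C((T−1)/2, D+1)·(T·K_{D+1} + 2(D+1)·K_D)` where `K_D, K_{D+1}` bound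
  `|Δ^D θ_odd|`, `|Δ^{D+1} θ_odd|` — a PURE REMAINDER: no tight-shell term, no `O(1/n)` corrections.
* §2 The instance the cell needs (MEMO-25 §2: the crossing direction of (CG_1′) is the block statistic MINUS THE
  HALF COUNT, Literature `crossing_containment_eq`): the statistic `ψ(|U∩H|)·|half_M(U) ∩ H|`. By Literature
  `shellInAvg_halfCount_blockStat_eq` its shell profile is `φ_M(c) = (c/n)·Σ_{v ∈ H} φ′_v(c−1)` with `φ′_v` the shell
  profile of the shifted block statistic `ψ(·+1)` on the ground set `[n] ∖ e_v` at the EVEN cut size `t−1` and even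
  levels; `fwdDiff_iter_one_even`, **`abs_fwdDiff_iter_deletedProfile_le`** (`|Δ^k_{(2)} φ′_v(c′)| ≤ G·ρ^k·X_k` from the
  Literature iterated `ℓ¹` bound on the deleted ground set, `ρ = m/(4(m−2))`), and the assembly
  **`abs_designValue_halfCount_blockStat_le`** (THE THEOREM):
  `| |PM|·Σ_U W(U,M)·ψ(|U∩H|)·|half_M(U)∩H| | ≤ (|H|/n)·G·[(2D+1)(C(2D,D)/4^D)·ρ^D X_D + B_v·C((T−1)/2,D+1)·(T·ρ^{D+1}X_{D+1} + 2(D+1)·ρ^D X_D)]`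
  for every exact design, matching, block, `|ψ| ≤ G`: with `X_k ≲ (Ck/n)^k` (bricks 118) this is `n^{−D+O(1)}`-small —
  "THE VIRTUAL LEVEL IS CROSSING-FREE" for smooth, non-junta profiles (for juntas it is brick 110b's `P_B(0) = 0`).
READING (MEMO-25): in the crossing plane `u = λ(𝟙_{HH} − 𝟙_{H̄H̄}) + μ𝟙` the tilted mask `ψ(X)·C_u²` is a block statistic
with level-polynomial coefficients plus half-count terms `Y·ψ(X)·(…)`, `Y²·ψ(X)` (`Y = |half U ∩ H|`); this brick prices
the `Y`-linear terms. WHAT THIS FILE DOES NOT DO: the `Y²` term (two half-vertices pinned), the virtual positivity of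
the remaining block statistic `ψ(x)(2x−t)²` (MEMO-25 §1: numerically the Gamma-continued hypergeometric law), anything
on `TracialDecayExp20` itself, psd rank, or P vs NP.
[cite: Rothvoss2017, §2 (PDF p. 6)] [cite: Agarwal2000DifferenceEquations, Thm. 1.8.5 (1.8.6), Remark 1.8.1 (1.8.8)]
[cite: Boole2009, Ch. II Art. 10 Ex. 3 eq. (8) (PDF pp. 34–35)] [cite: GriblingDelaatLaurent2019, §5]
Stature: support/instrument (kernel lane, no defs, axioms standard). Supports stmt-PneNP-19878.
-/

set_option linter.dupNamespace false -- `Summit.PneNP.PneNP.…`: summit = sub-problem (D-0017)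

noncomputable section

namespace Summit.PneNP.PneNP.Theorems.ChebyshevTracialDesignHalfPinnedNull

open Finset Polynomial Literature.Barriers.PneNP Literature.Combinatorics.Optimization
open Literature.Combinatorics.Optimization.ShellStep
open Summit.PneNP.PneNP.Theorems.ChebyshevTracialDesignShellOperatorForm (designValue_eq_shellAvg chooseXOdd_eval_zero
  shell_partner_nonempty)
open Summit.PneNP.PneNP.Theorems.ChebyshevTracialDesignBlockStatisticPricing (pairs_hyp rho_nonneg)

variable {n : ℕ}

/-! ### §1 Newton extrapolation of a level-vanishing profile is top-order -/

/-- Differences of the linear node factor `2j+1`: `Δ(2j+1) = 2`. [cite: Boole2009, Ch. II Art. 10 (PDF p. 34)] -/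
theorem fwdDiff_twoMulAddOne : fwdDiff (1 : ℕ) (fun j : ℕ => (2 * (j : ℝ) + 1)) = fun _ => (2 : ℝ) := by
  funext j
  simp only [fwdDiff, Nat.cast_add, Nat.cast_one]
  ring

/-- Iterated differences of the zero sequence vanish. [cite: Boole2009, Ch. II Art. 10 (PDF p. 34)] -/
theorem fwdDiff_iter_zero_seq (i : ℕ) : (fwdDiff (1 : ℕ))^[i] (0 : ℕ → ℝ) = 0 := by
  induction i with
  | zero => rfl
  | succ i ih =>
    rw [Function.iterate_succ_apply]
    have h0 : fwdDiff (1 : ℕ) (0 : ℕ → ℝ) = 0 := by funext j; simp [fwdDiff]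
    rw [h0, ih]

/-- `Δ^k(2j+1) = 0` for `k ≥ 2`. [cite: Boole2009, Ch. II Art. 10 (PDF p. 34)] -/
theorem fwdDiff_iter_twoMulAddOne_eq_zero (k : ℕ) (hk : 1 < k) :
    (fwdDiff (1 : ℕ))^[k] (fun j : ℕ => (2 * (j : ℝ) + 1)) = 0 := by
  obtain ⟨i, rfl⟩ := Nat.exists_eq_add_of_le hk
  have h2 : (fwdDiff (1 : ℕ))^[2] (fun j : ℕ => (2 * (j : ℝ) + 1)) = 0 := by
    rw [Function.iterate_succ_apply, Function.iterate_one, fwdDiff_twoMulAddOne]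
    funext j; simp [fwdDiff]
  rw [show Nat.succ 1 + i = i + 2 by omega, Function.iterate_add_apply, h2, fwdDiff_iter_zero_seq]

/-- **Leibniz for the node factor**: `Δ^k[(2j+1)·g(j)](y) = (2y+1)·Δ^k g(y) + 2k·Δ^{k−1} g(y+1)`.
[cite: Boole2009, Ch. II Art. 10 Ex. 3 eq. (8) (PDF pp. 34–35)] -/
theorem fwdDiff_iter_levelMul (g : ℕ → ℝ) (k y : ℕ) :
    (fwdDiff (1 : ℕ))^[k] (fun j : ℕ => (2 * (j : ℝ) + 1) * g j) y =
      (2 * (y : ℝ) + 1) * (fwdDiff (1 : ℕ))^[k] g y + 2 * (k : ℝ) * (fwdDiff (1 : ℕ))^[k - 1] g (y + 1) := by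
  have hfg : (fun j : ℕ => (2 * (j : ℝ) + 1) * g j) = (fun j : ℕ => (2 * (j : ℝ) + 1)) • g := by
    funext j; simp
  rw [hfg, Literature.Analysis.fwdDiff_iter_smul_eq_sum_of_eq_zero (1 : ℕ) (fun j : ℕ => (2 * (j : ℝ) + 1)) g
    (d := 1) (fun k hk => fwdDiff_iter_twoMulAddOne_eq_zero k hk) k y]
  simp only [sum_range_succ, sum_range_zero, zero_add, Nat.choose_zero_right, Function.iterate_zero,
    id_eq, Nat.sub_zero, Nat.choose_one_right, Function.iterate_one,
    fwdDiff_twoMulAddOne, smul_eq_mul, nsmul_eq_mul]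
  ring

/-- **The binomial-series recursion at `−½`**: `(2k+1)·C(−½,k) + 2(k+1)·C(−½,k+1) = 0`, i.e.
`C(−½,k+1) = −((2k+1)/(2k+2))·C(−½,k)`. [cite: Agarwal2000DifferenceEquations, Thm. 1.8.5 (1.8.6)] -/
theorem chooseXOdd_eval_zero_succ_rel (k : ℕ) :
    (2 * (k : ℝ) + 1) * (DesignRemainder.chooseXOdd k).eval 0 +
      2 * ((k : ℝ) + 1) * (DesignRemainder.chooseXOdd (k + 1)).eval 0 = 0 := by
  rw [chooseXOdd_eval_zero, chooseXOdd_eval_zero]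
  have hrec : ((k : ℝ) + 1) * (((2 * (k + 1)).choose (k + 1) : ℕ) : ℝ) =
      2 * (2 * (k : ℝ) + 1) * (((2 * k).choose k : ℕ) : ℝ) := by
    have h := Nat.succ_mul_centralBinom_succ k
    rw [Nat.centralBinom, Nat.centralBinom] at h
    have h' : ((k + 1 : ℕ) : ℝ) * (((2 * (k + 1)).choose (k + 1) : ℕ) : ℝ) =
        ((2 * (2 * k + 1) : ℕ) : ℝ) * (((2 * k).choose k : ℕ) : ℝ) := by exact_mod_cast h
    push_cast at h'
    linarith
  rw [pow_succ, pow_succ]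
  have h4 : (4 : ℝ) ^ k ≠ 0 := by positivity
  field_simp
  linear_combination (-2 : ℝ) * (-1 : ℝ) ^ k * hrec

/-- **Newton extrapolation of a level-vanishing profile**: for every `θ : ℕ → ℝ`,
`N^{odd}_D[c ↦ c·θ(c)](0) = (2D+1)·C(−½,D)·Δ^D θ_odd(0)`, `θ_odd(j) = θ(2j+1)` — the degree-`D` Newton extrapolation,
from the odd levels `1, 3, …, 2D+1` to the virtual level `0`, of a profile with the factor `c` is a single difference of
top order `D` (all lower orders cancel). [cite: Agarwal2000DifferenceEquations, Thm. 1.8.5 (1.8.6)] -/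
theorem newtonPolyOdd_levelMul_eval_zero (D : ℕ) (θ : ℕ → ℝ) :
    (DesignRemainder.newtonPolyOdd D (fun c => (c : ℝ) * θ c)).eval 0 =
      (2 * (D : ℝ) + 1) * (DesignRemainder.chooseXOdd D).eval 0 * (fwdDiff (1 : ℕ))^[D] (fun j => θ (2 * j + 1)) 0 := by
  -- the odd subsequence of `c·θ(c)` is `(2j+1)·θ_odd(j)`
  have hsub : (fun j : ℕ => (((2 * j + 1 : ℕ) : ℝ)) * θ (2 * j + 1)) = fun j : ℕ => (2 * (j : ℝ) + 1) * θ (2 * j + 1) := by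
    funext j; push_cast; ring
  induction D with
  | zero =>
    rw [DesignRemainder.newtonPolyOdd_eq_sum, eval_finsetSum, zero_add, sum_range_one, eval_mul, eval_C,
      chooseXOdd_eval_zero]
    simp
  | succ D ih =>
    have hstep : DesignRemainder.newtonPolyOdd (D + 1) (fun c => (c : ℝ) * θ c) =
        DesignRemainder.newtonPolyOdd D (fun c => (c : ℝ) * θ c) +
          Polynomial.C ((fwdDiff (1 : ℕ))^[D + 1] (fun j : ℕ => (((2 * j + 1 : ℕ) : ℝ)) * θ (2 * j + 1)) 0) *
            DesignRemainder.chooseXOdd (D + 1) := by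
      rw [DesignRemainder.newtonPolyOdd_eq_sum, DesignRemainder.newtonPolyOdd_eq_sum, sum_range_succ]
    rw [hstep, eval_add, ih, eval_mul, eval_C, hsub, fwdDiff_iter_levelMul, Nat.add_sub_cancel]
    -- `Δ^D g(1) = Δ^D g(0) + Δ^{D+1} g(0)`
    have hshift : (fwdDiff (1 : ℕ))^[D] (fun j => θ (2 * j + 1)) (0 + 1) =
        (fwdDiff (1 : ℕ))^[D] (fun j => θ (2 * j + 1)) 0 + (fwdDiff (1 : ℕ))^[D + 1] (fun j => θ (2 * j + 1)) 0 := by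
      rw [Function.iterate_succ_apply', fwdDiff]
      ring
    rw [hshift]
    have hrel := chooseXOdd_eval_zero_succ_rel D
    push_cast
    linear_combination ((fwdDiff (1 : ℕ))^[D] (fun j => θ (2 * j + 1)) 0) * hrel

/-- **Design value of a level-vanishing profile is a pure remainder.** For `(C, w)` exact of degree `D` at the virtual
level (`Σ_c w_c p(c) = −p(0)`, `deg p ≤ D`) on odd levels `≤ T` with `Σ_c |w_c| ≤ B`, `2D+1 ≤ T`, and a profile `θ` with
`|Δ^D θ_odd(j)| ≤ K_D` (`2(j+D)+1 ≤ T`) and `|Δ^{D+1} θ_odd(j)| ≤ K_{D+1}` (`2(j+D+1)+1 ≤ T`):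
`|Σ_c w_c·c·θ(c)| ≤ (2D+1)·(C(2D,D)/4^D)·K_D + B·C((T−1)/2, D+1)·(T·K_{D+1} + 2(D+1)·K_D)`.
[cite: Agarwal2000DifferenceEquations, Remark 1.8.1 (1.8.8)] [cite: Rivlin1974, Sect. 1.3 (1.32)–(1.34)] -/
theorem abs_levelSum_levelMul_le {C : Finset ℕ} {w : ℕ → ℝ} {D : ℕ}
    (hex : ∀ p : ℝ[X], p.natDegree ≤ D → ∑ c ∈ C, w c * p.eval (c : ℝ) = -p.eval 0)
    {B : ℝ} (hB : ∑ c ∈ C, |w c| ≤ B) {T : ℕ} (hT : ∀ c ∈ C, c ≤ T) (hodd : ∀ c ∈ C, Odd c) (hDT : 2 * D + 1 ≤ T)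
    (θ : ℕ → ℝ) {KD KD1 : ℝ} (hKD0 : 0 ≤ KD) (hKD10 : 0 ≤ KD1)
    (hKD : ∀ j : ℕ, 2 * (j + D) + 1 ≤ T → |((fwdDiff (1 : ℕ))^[D] (fun j => θ (2 * j + 1))) j| ≤ KD)
    (hKD1 : ∀ j : ℕ, 2 * (j + D + 1) + 1 ≤ T → |((fwdDiff (1 : ℕ))^[D + 1] (fun j => θ (2 * j + 1))) j| ≤ KD1) :
    |∑ c ∈ C, w c * ((c : ℝ) * θ c)| ≤
      (2 * (D : ℝ) + 1) * ((((2 * D).choose D : ℕ) : ℝ) / (4 : ℝ) ^ D) * KD +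
        B * ((((T - 1) / 2).choose (D + 1) : ℕ) : ℝ) * ((T : ℝ) * KD1 + 2 * ((D : ℝ) + 1) * KD) := by
  have hB0 : 0 ≤ B := le_trans (sum_nonneg fun c _ => abs_nonneg _) hB
  -- the remainder estimate for `φ(c) = c·θ(c)`
  have hsub : (fun j : ℕ => (((2 * j + 1 : ℕ) : ℝ)) * θ (2 * j + 1)) = fun j : ℕ => (2 * (j : ℝ) + 1) * θ (2 * j + 1) := by
    funext j; push_cast; ring
  have hK : ∀ j : ℕ, 2 * (j + D + 1) + 1 ≤ T →
      |((fwdDiff (1 : ℕ))^[D + 1] (fun j => (((2 * j + 1 : ℕ) : ℝ)) * θ (2 * j + 1))) j| ≤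
        (T : ℝ) * KD1 + 2 * ((D : ℝ) + 1) * KD := by
    intro j hj
    rw [hsub, fwdDiff_iter_levelMul, Nat.add_sub_cancel]
    have h1 := hKD1 j hj
    have h2 := hKD (j + 1) (by omega)
    have hjT : 2 * (j : ℝ) + 1 ≤ T := by exact_mod_cast (show 2 * j + 1 ≤ T by omega)
    calc |(2 * (j : ℝ) + 1) * (fwdDiff (1 : ℕ))^[D + 1] (fun j => θ (2 * j + 1)) j +
            2 * ((D + 1 : ℕ) : ℝ) * (fwdDiff (1 : ℕ))^[D] (fun j => θ (2 * j + 1)) (j + 1)|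
        ≤ |(2 * (j : ℝ) + 1) * (fwdDiff (1 : ℕ))^[D + 1] (fun j => θ (2 * j + 1)) j| +
            |2 * ((D + 1 : ℕ) : ℝ) * (fwdDiff (1 : ℕ))^[D] (fun j => θ (2 * j + 1)) (j + 1)| := abs_add_le _ _
      _ ≤ (T : ℝ) * KD1 + 2 * ((D : ℝ) + 1) * KD := by
          rw [abs_mul, abs_mul, abs_of_nonneg (by positivity : (0 : ℝ) ≤ 2 * (j : ℝ) + 1),
            abs_of_nonneg (by positivity : (0 : ℝ) ≤ 2 * ((D + 1 : ℕ) : ℝ))]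
          push_cast
          gcongr
  have hrem := abs_levelSum_add_le_of_exact_of_fwdDiff_odd hex hB hT hodd (fun c => (c : ℝ) * θ c)
    (by positivity) hK
  rw [newtonPolyOdd_levelMul_eval_zero] at hrem
  -- the virtual value is top-order
  have hmain : |(2 * (D : ℝ) + 1) * (DesignRemainder.chooseXOdd D).eval 0 *
      (fwdDiff (1 : ℕ))^[D] (fun j => θ (2 * j + 1)) 0| ≤
      (2 * (D : ℝ) + 1) * ((((2 * D).choose D : ℕ) : ℝ) / (4 : ℝ) ^ D) * KD := by
    rw [abs_mul, abs_mul, chooseXOdd_eval_zero, abs_of_nonneg (by positivity : (0 : ℝ) ≤ 2 * (D : ℝ) + 1)]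
    have habs : |(-1 : ℝ) ^ D * (((2 * D).choose D : ℕ) : ℝ) / (4 : ℝ) ^ D| =
        (((2 * D).choose D : ℕ) : ℝ) / (4 : ℝ) ^ D := by
      rw [mul_div_assoc, abs_mul, abs_pow, abs_neg, abs_one, one_pow, one_mul, abs_of_nonneg (by positivity)]
    rw [habs]
    exact mul_le_mul_of_nonneg_left (hKD 0 (by omega)) (by positivity)
  have := abs_add_le (∑ c ∈ C, w c * ((c : ℝ) * θ c) + (2 * (D : ℝ) + 1) * (DesignRemainder.chooseXOdd D).eval 0 *
      (fwdDiff (1 : ℕ))^[D] (fun j => θ (2 * j + 1)) 0)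
    (-((2 * (D : ℝ) + 1) * (DesignRemainder.chooseXOdd D).eval 0 * (fwdDiff (1 : ℕ))^[D] (fun j => θ (2 * j + 1)) 0))
  rw [abs_neg, add_neg_cancel_right] at this
  linarith

/-! ### §2 The half-count-weighted block statistic `ψ(|U∩H|)·|half_M(U) ∩ H|` -/

/-- Step-`1` differences of the EVEN-level subsequence are step-`2` differences of the profile:
`Δ^k_{(1)}[j ↦ φ(2j)](j) = Δ^k_{(2)}[φ](2j)`. [cite: Agarwal2000DifferenceEquations, Thm. 1.8.5 (1.8.6)] -/
theorem fwdDiff_iter_one_even (φ : ℕ → ℝ) (k j : ℕ) :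
    ((fwdDiff (1 : ℕ))^[k] (fun j : ℕ => φ (2 * j))) j = ((fwdDiff (2 : ℕ))^[k] φ) (2 * j) := by
  rw [fwdDiff_iter_eq_sum_shift, fwdDiff_iter_eq_sum_shift]
  refine sum_congr rfl fun i _ => ?_
  simp only [smul_eq_mul, mul_one]
  ring_nf

/-- Iterated differences of a scalar multiple of a finite sum of sequences.
[cite: Boole2009, Ch. II Art. 10 (PDF p. 34)] -/
theorem fwdDiff_iter_mul_sum {ι : Type*} (s : Finset ι) (a : ℝ) (f : ι → ℕ → ℝ) (k j : ℕ) :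
    (fwdDiff (1 : ℕ))^[k] (fun j => a * ∑ v ∈ s, f v j) j = a * ∑ v ∈ s, (fwdDiff (1 : ℕ))^[k] (f v) j := by
  rw [fwdDiff_iter_eq_sum_shift]
  have hv : ∀ v ∈ s, (fwdDiff (1 : ℕ))^[k] (f v) j =
      ∑ i ∈ range (k + 1), ((-1 : ℤ) ^ (k - i) * (k.choose i : ℤ)) • f v (j + i • 1) := by
    intro v _; rw [fwdDiff_iter_eq_sum_shift]
  rw [sum_congr rfl hv, sum_comm, mul_sum]
  refine sum_congr rfl fun i _ => ?_
  simp only [zsmul_eq_mul, mul_sum, smul_eq_mul]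
  exact sum_congr rfl fun v _ => by ring

/-- **The shell profile of `ψ(|U∩H|)·|half_M(U) ∩ H|` at a matching.** For a perfect matching `M` (partner map `π`),
an odd cut size `t = t₀ + 1` and an odd level `c = c₀ + 1` with `c ≤ t`, `t + c ≤ n`:
`E_{Shell_c(M)}[|half_M U ∩ H|·ψ(|U∩H|)] = (c/n)·Σ_{v ∈ H} E_{Shell_{[n]∖e_v}(t₀, c₀)}[ψ(|W∩H|+1)]`
(Literature `shellInAvg_halfCount_blockStat_eq` on the full ground set). [cite: Rothvoss2017, §2 (PDF p. 6)] -/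
theorem shellAvg_halfCount_blockStat_eq (M : PMatch n) (H : Finset (Fin n)) (ψ : ℤ → ℝ) {t₀ c₀ : ℕ}
    (ht : Odd (t₀ + 1)) (hc : Odd (c₀ + 1)) (hct : c₀ + 1 ≤ t₀ + 1) (hn : t₀ + 1 + (c₀ + 1) ≤ n) :
    (∑ U ∈ shell M.2.partner (t₀ + 1) (c₀ + 1),
        ((half M.2.partner U ∩ H).card : ℝ) * ψ ((U ∩ H).card : ℤ)) / ((shell M.2.partner (t₀ + 1) (c₀ + 1)).card : ℝ) =
      ((((c₀ : ℝ) + 1)) / (n : ℝ)) * ∑ v ∈ H,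
        (∑ W ∈ shellIn M.2.partner (univ \ {v, M.2.partner v}) t₀ c₀, ψ (((W ∩ H).card : ℤ) + 1)) /
          ((shellIn M.2.partner (univ \ {v, M.2.partner v}) t₀ c₀).card : ℝ) := by
  have hπ : ∀ v, M.2.partner (M.2.partner v) = v := partner_partner M
  have hπ' : ∀ v, M.2.partner v ≠ v := partner_ne M
  have hne : (shellIn M.2.partner univ (t₀ + 1) (c₀ + 1)).Nonempty := by
    rw [shellIn_univ]; exact shell_partner_nonempty M ht hc hct hn
  have h := shellInAvg_halfCount_blockStat_eq hπ hπ' (S := univ) (fun u _ => mem_univ _) H t₀ c₀ ψ hne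
  rw [shellIn_univ, univ_inter, card_univ, Fintype.card_fin] at h
  exact h

/-- **Level differences of a deleted, shifted block-statistic profile.** For a perfect matching `M` (partner map
`π`), a vertex `v`, a block `H`, `|ψ| ≤ G` on `[1, t₀+1]` (so `|ψ(·+1)| ≤ G` on `[0,t₀]`), an EVEN cut size
`t₀ = t₀′ + 2k` and an even level `c′` with `c′ + 2k + 1 ≤ t₀ + 1`, `t₀ + 1 + (c′ + 2k + 1) ≤ n`, `m ≥ 3`, `m + 4k + 2 ≤ n`: if every
`π`-stable `S′` with `|S′| + 4k + 2 = n` has `Σ_{x=0}^{t₀} |(∇²)^k law_{S′}(t₀′,·)(c′)(x)| ≤ X`, then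
`|Δ^k_{(2)}[c ↦ E_{Shell_{[n]∖e_v}(t₀,c)}[ψ(|W∩H|+1)]](c′)| ≤ G·ρ^k·X`, `ρ = m/(4(m−2))` (Literature iterated `ℓ¹` bound on the
deleted ground set; its shells are nonempty because the shells of `M` one level up are).
[cite: Rothvoss2017, §2 (PDF p. 6)] [cite: RollinRoss2010, §3 (Lemma 3.1)] -/
theorem abs_fwdDiff_iter_deletedProfile_le (M : PMatch n) (v : Fin n) (H : Finset (Fin n)) (ψ : ℤ → ℝ) {G : ℝ}
    (hG0 : 0 ≤ G) {t₀' k c' m : ℕ} (hG : ∀ x ∈ Icc (0 : ℤ) ((t₀' + 2 * k : ℕ) : ℤ), |ψ (x + 1)| ≤ G)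
    (ht : Odd (t₀' + 2 * k + 1)) (hc : Even c') (hct : c' + 2 * k + 1 ≤ t₀' + 2 * k + 1)
    (hn : t₀' + 2 * k + 1 + (c' + 2 * k + 1) ≤ n) (hm : 3 ≤ m) (hmn : m + 4 * k + 2 ≤ n) {X : ℝ} (hX0 : 0 ≤ X)
    (hX : ∀ S' : Finset (Fin n), (∀ u ∈ S', M.2.partner u ∈ S') → S'.card + 4 * k + 2 = n →
      ∑ x ∈ Icc (0 : ℤ) ((t₀' + 2 * k : ℕ) : ℤ),
        |nab2^[k] (fun c x => shellLaw M.2.partner S' H t₀' c x : Profile) c' x| ≤ X) :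
    |((fwdDiff (2 : ℕ))^[k] (fun c => (∑ W ∈ shellIn M.2.partner (univ \ {v, M.2.partner v}) (t₀' + 2 * k) c,
        ψ (((W ∩ H).card : ℤ) + 1)) / ((shellIn M.2.partner (univ \ {v, M.2.partner v}) (t₀' + 2 * k) c).card : ℝ))) c'| ≤
      G * (((m : ℝ) / (4 * ((m : ℝ) - 2))) ^ k * X) := by
  set π := M.2.partner with hπdef
  have hπ : ∀ v, π (π v) = v := partner_partner M
  have hπ' : ∀ v, π v ≠ v := partner_ne M
  set S : Finset (Fin n) := univ \ {v, π v} with hSdef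
  have hS : ∀ u ∈ S, π u ∈ S := sdiff_pair_stable hπ (S := univ) (fun u _ => mem_univ _) v
  have hScard : S.card + 2 = n := by
    have := card_sdiff_pair hπ' (S := univ) (fun u _ => mem_univ _) (mem_univ v)
    rwa [card_univ, Fintype.card_fin] at this
  refine (abs_fwdDiff_iter_shellInAvg_le S H (t₀' + 2 * k) k c' (fun x => ψ (x + 1)) hG).trans
    (mul_le_mul_of_nonneg_left ?_ hG0)
  have hρ0 : (0 : ℝ) ≤ (m : ℝ) / (4 * ((m : ℝ) - 2)) := rho_nonneg hm
  -- nonemptiness of the deleted shell at the top level, from the shell of `M` one level up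
  have hne : (shellIn π S (t₀' + 2 * k) (c' + 2 * k)).Nonempty := by
    refine shellIn_sdiff_pair_nonempty_of_half hπ hπ' (S := univ) (fun u _ => mem_univ _) (mem_univ v) ?_
    rw [shellIn_univ]
    exact shell_partner_nonempty M ht (by obtain ⟨i, hi⟩ := hc; exact ⟨i + k, by omega⟩) hct hn
  have h := sum_abs_nab2_iter_fwdDiff_iter_le hπ hπ' H t₀' (Icc (0 : ℤ) ((t₀' + 2 * k : ℕ) : ℤ)) hρ0 hX0 k 0
    hS c' hne
    (fun S' _ hS' hlt => pairs_hyp hπ H hm S' hS' (by omega))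
    (fun S' _ hS' heq => by
      rw [zero_add]
      exact hX S' hS' (by omega))
  simpa using h

/-- **HALF-PINNED BLOCK STATISTICS ARE VIRTUALLY NULL (brick 119).** For an exact design `(n,t,T,D,B_v,C,w)` with
`t = t₀′ + 2(D+1) + 1`, a perfect matching `M` (partner map `π`), a block `H`, a profile `|ψ| ≤ G` on `[0,t]`, `m ≥ 3` with
`m + 4(D+1) + 2 ≤ n`, `2D+1 ≤ T`, and `x`-smoothness numbers `X_D, X_{D+1} ≥ 0` of the deleted shell laws at EVEN base levels
(`Σ_{x=0}^{t−1} |(∇²)^k law_{S′}(t−1−2k,·)(c′)(x)| ≤ X_k` for `k ∈ {D, D+1}`, every even `c′` with `c′ + 2k + 1 ≤ T`, every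
`π`-stable `S′` with `|S′| + 4k + 2 = n`):
`| |PM|·Σ_U W(U,M)·(|half_M U ∩ H|·ψ(|U∩H|)) | ≤ (2D+1)·(C(2D,D)/4^D)·K_D + B_v·C((T−1)/2,D+1)·(T·K_{D+1} + 2(D+1)·K_D)`
with `K_k = (|H|/n)·G·ρ^k·X_k`, `ρ = m/(4(m−2))` — NO tight-shell term and NO lower-order Newton corrections: the block
statistic weighted by the number of crossing `H`-vertices is priced at the pure remainder scale.
[cite: Rothvoss2017, §2 (PDF p. 6)] [cite: Agarwal2000DifferenceEquations, Thm. 1.8.5 (1.8.6), Remark 1.8.1 (1.8.8)]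
[cite: GriblingDelaatLaurent2019, §5] -/
theorem abs_designValue_halfCount_blockStat_le {t₀' T D : ℕ} {Bv : ℝ} {C : Finset ℕ} {w : ℕ → ℝ}
    (hdes : IsExactDesign n (t₀' + 2 * (D + 1) + 1) T D Bv C w) (hDT : 2 * D + 1 ≤ T) (M : PMatch n)
    (H : Finset (Fin n)) (ψ : ℤ → ℝ) {G : ℝ} (hG0 : 0 ≤ G)
    (hG : ∀ x ∈ Icc (0 : ℤ) ((t₀' + 2 * (D + 1) + 1 : ℕ) : ℤ), |ψ x| ≤ G)
    {m : ℕ} (hm : 3 ≤ m) (hmn : m + 4 * (D + 1) + 2 ≤ n) (X : ℕ → ℝ) (hX0 : ∀ k, 0 ≤ X k)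
    (hX : ∀ k, D ≤ k → k ≤ D + 1 → ∀ c' : ℕ, Even c' → c' + 2 * k + 1 ≤ T →
      ∀ S' : Finset (Fin n), (∀ u ∈ S', M.2.partner u ∈ S') → S'.card + 4 * k + 2 = n →
      ∑ x ∈ Icc (0 : ℤ) ((t₀' + 2 * (D + 1) : ℕ) : ℤ),
        |nab2^[k] (fun c x => shellLaw M.2.partner S' H (t₀' + 2 * (D + 1) - 2 * k) c x : Profile) c' x| ≤ X k) :
    |(Fintype.card (PMatch n) : ℝ) * ∑ U : OddSet n, levelWeight n (t₀' + 2 * (D + 1) + 1) C w U M *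
        (((half M.2.partner U.1 ∩ H).card : ℝ) * ψ ((U.1 ∩ H).card : ℤ))| ≤
      (2 * (D : ℝ) + 1) * ((((2 * D).choose D : ℕ) : ℝ) / (4 : ℝ) ^ D) *
          (((H.card : ℝ) / n) * (G * (((m : ℝ) / (4 * ((m : ℝ) - 2))) ^ D * X D))) +
        Bv * ((((T - 1) / 2).choose (D + 1) : ℕ) : ℝ) *
          ((T : ℝ) * (((H.card : ℝ) / n) * (G * (((m : ℝ) / (4 * ((m : ℝ) - 2))) ^ (D + 1) * X (D + 1)))) +
            2 * ((D : ℝ) + 1) * (((H.card : ℝ) / n) * (G * (((m : ℝ) / (4 * ((m : ℝ) - 2))) ^ D * X D)))) := by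
  set t₀ := t₀' + 2 * (D + 1) with ht₀def
  set π := M.2.partner with hπdef
  have ht : Odd (t₀ + 1) := hdes.1
  have h2t : 2 * (t₀ + 1) + 2 ≤ n := hdes.2.1
  have hTt : T ≤ t₀ + 1 := hdes.2.2.1
  have hPM : (0 : ℝ) < (Fintype.card (PMatch n) : ℝ) := by
    have : 0 < Fintype.card (PMatch n) := Fintype.card_pos_iff.2 ⟨M⟩
    exact_mod_cast this
  have hn0 : (0 : ℝ) < n := by
    have : 0 < n := by omega
    exact_mod_cast this
  -- the deleted, shifted profiles and `θ`
  set φ' : Fin n → ℕ → ℝ := fun v c => (∑ W ∈ shellIn π (univ \ {v, π v}) t₀ c, ψ (((W ∩ H).card : ℤ) + 1)) /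
    ((shellIn π (univ \ {v, π v}) t₀ c).card : ℝ) with hφ'
  set θ : ℕ → ℝ := fun c => (1 / (n : ℝ)) * ∑ v ∈ H, φ' v (c - 1) with hθ
  -- Step 1: `|PM|·Σ_U W g = Σ_c w_c φ_M(c) = Σ_c w_c (c·θ(c))`
  have hval : (Fintype.card (PMatch n) : ℝ) * ∑ U : OddSet n, levelWeight n (t₀ + 1) C w U M *
      (((half π U.1 ∩ H).card : ℝ) * ψ ((U.1 ∩ H).card : ℤ)) = ∑ c ∈ C, w c * ((c : ℝ) * θ c) := by
    rw [designValue_eq_shellAvg (t₀ + 1) ht C w M (fun U => ((half π U ∩ H).card : ℝ) * ψ ((U ∩ H).card : ℤ)),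
      ← mul_assoc, mul_inv_cancel₀ hPM.ne', one_mul]
    refine sum_congr rfl fun c hc => ?_
    obtain ⟨hcodd, h3c, hcT, -⟩ := hdes.2.2.2.1 c hc
    obtain ⟨c₀, rfl⟩ : ∃ c₀, c = c₀ + 1 := ⟨c - 1, by omega⟩
    congr 1
    rw [shellAvg_halfCount_blockStat_eq M H ψ ht hcodd (by omega) (by omega), hθ]
    simp only [Nat.add_sub_cancel]
    push_cast
    ring
  rw [hval]
  -- Step 2: the level-difference bounds for `θ_odd`
  have hG' : ∀ x ∈ Icc (0 : ℤ) ((t₀ : ℕ) : ℤ), |ψ (x + 1)| ≤ G := by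
    intro x hx
    refine hG (x + 1) ?_
    rw [mem_Icc] at hx ⊢
    constructor
    · linarith [hx.1]
    · have := hx.2; push_cast at this ⊢; linarith
  have hθodd : ∀ j : ℕ, θ (2 * j + 1) = (1 / (n : ℝ)) * ∑ v ∈ H, φ' v (2 * j) := by
    intro j; rw [hθ]; simp only [Nat.add_sub_cancel]
  have hKgen : ∀ k, D ≤ k → k ≤ D + 1 → ∀ j : ℕ, 2 * (j + k) + 1 ≤ T →
      |((fwdDiff (1 : ℕ))^[k] (fun j => θ (2 * j + 1))) j| ≤
        ((H.card : ℝ) / n) * (G * (((m : ℝ) / (4 * ((m : ℝ) - 2))) ^ k * X k)) := by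
    intro k hDk hkD j hj
    have hfun : (fun j => θ (2 * j + 1)) = fun j => (1 / (n : ℝ)) * ∑ v ∈ H, (fun v j => φ' v (2 * j)) v j := by
      funext j; rw [hθodd]
    rw [hfun, fwdDiff_iter_mul_sum, abs_mul, abs_of_nonneg (by positivity : (0 : ℝ) ≤ 1 / (n : ℝ))]
    have hsplit : t₀ = (t₀ - 2 * k) + 2 * k := by omega
    have hbd : ∀ v ∈ H, |(fwdDiff (1 : ℕ))^[k] (fun j => φ' v (2 * j)) j| ≤
        G * (((m : ℝ) / (4 * ((m : ℝ) - 2))) ^ k * X k) := by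
      intro v _
      rw [fwdDiff_iter_one_even, hφ']
      simp only
      rw [hsplit]
      refine abs_fwdDiff_iter_deletedProfile_le M v H ψ hG0 (by rw [← hsplit]; exact hG')
        (by rw [← hsplit]; exact ht) ⟨j, by ring⟩ (by omega) (by omega) hm (by omega) (hX0 k) ?_
      intro S' hS' hcard
      have := hX k hDk hkD (2 * j) ⟨j, by ring⟩ (by omega) S' hS' hcard
      rw [← hsplit]
      convert this using 4
    have hsum : |∑ v ∈ H, (fwdDiff (1 : ℕ))^[k] (fun j => φ' v (2 * j)) j| ≤
        (H.card : ℝ) * (G * (((m : ℝ) / (4 * ((m : ℝ) - 2))) ^ k * X k)) :=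
      calc |∑ v ∈ H, (fwdDiff (1 : ℕ))^[k] (fun j => φ' v (2 * j)) j|
          ≤ ∑ v ∈ H, |(fwdDiff (1 : ℕ))^[k] (fun j => φ' v (2 * j)) j| := abs_sum_le_sum_abs _ _
        _ ≤ ∑ v ∈ H, G * (((m : ℝ) / (4 * ((m : ℝ) - 2))) ^ k * X k) := sum_le_sum hbd
        _ = (H.card : ℝ) * (G * (((m : ℝ) / (4 * ((m : ℝ) - 2))) ^ k * X k)) := by rw [sum_const, nsmul_eq_mul]
    calc 1 / (n : ℝ) * |∑ v ∈ H, (fwdDiff (1 : ℕ))^[k] (fun j => φ' v (2 * j)) j|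
        ≤ 1 / (n : ℝ) * ((H.card : ℝ) * (G * (((m : ℝ) / (4 * ((m : ℝ) - 2))) ^ k * X k))) :=
          mul_le_mul_of_nonneg_left hsum (by positivity)
      _ = ((H.card : ℝ) / n) * (G * (((m : ℝ) / (4 * ((m : ℝ) - 2))) ^ k * X k)) := by ring
  -- Step 3: the abstract remainder estimate
  have hρ0 : (0 : ℝ) ≤ (m : ℝ) / (4 * ((m : ℝ) - 2)) := rho_nonneg hm
  have hK0 : ∀ k, 0 ≤ ((H.card : ℝ) / n) * (G * (((m : ℝ) / (4 * ((m : ℝ) - 2))) ^ k * X k)) := fun k =>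
    mul_nonneg (div_nonneg (Nat.cast_nonneg _) (Nat.cast_nonneg _))
      (mul_nonneg hG0 (mul_nonneg (pow_nonneg hρ0 k) (hX0 k)))
  exact abs_levelSum_levelMul_le hdes.exact hdes.variation_le hdes.level_le (fun c hc => (hdes.2.2.2.1 c hc).1) hDT θ
    (hK0 D) (hK0 (D + 1))
    (fun j hj => hKgen D le_rfl (by omega) j hj) (fun j hj => hKgen (D + 1) (by omega) le_rfl j hj)

end Summit.PneNP.PneNP.Theorems.ChebyshevTracialDesignHalfPinnedNull

end
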